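import Literature.Algebra.Homology.ContCohomologyInnerDegreeTwo
import Literature.AnabelianGeometry.AbsoluteAnabelian.AbsTopIII.GeometricCyclotomeModule
import HarnessLib

/-!
# `Δ_X` acts trivially on the cyclotome `M_X(Λ) = Hom(H²(Δ_X, Λ), Λ)`: the `Π_X`-action factors
# through `G_k` ([AbsTopIII] Prop. 1.4 (ii), proof-only companion)

Mochizuki, *Topics in Absolute Anabelian Geometry III*, Prop. 1.4 (ii) p. 31 and Cor. 1.10 (ii)(c)
p. 42 treat `M_X := Hom(H²(Δ_X, Ẑ), Ẑ)` as a `G_k`-MODULE ("the natural isomorphism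
`μ_Ẑ(G_k) ⥲ M_X`", cyclotomic synchronization): the conjugation action of `Π_X` on `Δ_X` induces an
action on `H²(Δ_X, Ẑ)` and "since inner automorphisms of `Δ_X` act trivially on cohomology, `G_k`
acts" (docstring of abc-iut-L4-t1's `GeometricCyclotome.lean`, p408196, where this step was left
unproved).  abc-iut-L4-t1 made `M_X(Λ)` REAL (`CyclotomeMod E Λ`, `cyclotomeModRep E Λ :
ContRepresentation ℤ Π_X (CyclotomeMod E Λ)`, `GeometricCyclotomeModule.lean` p408430).  THIS FILE
PROVES, from the generic theorem "inner automorphisms act trivially on continuous `H²`"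
(`ContinuousCohomology.map_two_eq_id_of_inner`, `Literature/Algebra/Homology/ContCohomologyInnerDegreeTwo.lean`):

* `geomH2Map_of_mem_geom`: for `g ∈ Δ_X`, `H²(c_g) = 𝟙` on `H²(Δ_X, Λ)`;
* `cyclotomeModRep_of_mem_geom`: `Δ_X` acts trivially on `M_X(Λ)`;
* `cyclotomeModRep_eq_of_aug_eq`: the action of `g ∈ Π_X` on `M_X(Λ)` depends only on its image in
  `G_k`; `exists_cyclotomeModRep_factor`: the action is pulled back from a (unique on the image,
  i.e. everywhere, `Π_X ↠ G_k` being surjective) homomorphism `G_k → End(M_X(Λ))`.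

All declarations are theorems; `Δ_X ⊆ Π_X` closed in a profinite group is compact, hence locally
compact, which is what the generic theorem needs.  HONEST FRAMING: elementary group cohomology; no
side taken on [IUTchIII] Cor. 3.12.
-/

noncomputable section

open CategoryTheory

namespace Literature.AnabelianGeometry.AbsoluteAnabelian.AbsTopIII

universe u

variable (E : FundamentalExtension.{u}) (Λ : Type u) [AddCommGroup Λ] [TopologicalSpace Λ]
  [IsTopologicalAddGroup Λ]

/-- `Δ_X` (closed in the profinite `Π_X`) is compact. [cite: MochizukiAbsTopIII2015, Prop 1.4 (ii) p.31] -/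
theorem compactSpace_geom : CompactSpace E.geom :=
  isCompact_iff_compactSpace.mp E.isClosed_geom.isCompact

/-- `Δ_X` is locally compact. [cite: MochizukiAbsTopIII2015, Prop 1.4 (ii) p.31] -/
theorem locallyCompactSpace_geom : LocallyCompactSpace E.geom := by
  haveI := compactSpace_geom E
  infer_instance

/-- **Inner automorphisms of `Δ_X` act trivially on `H²(Δ_X, Λ)`**: for `g ∈ Δ_X`,
`H²(c_g) = 𝟙`. [cite: MochizukiAbsTopIII2015, Prop 1.4 (ii) p.31] -/
theorem geomH2Map_of_mem_geom {g : E.arith} (hg : g ∈ E.geom) :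
    geomH2Map E Λ g = 𝟙 (geomH2 E Λ) := by
  haveI := locallyCompactSpace_geom E
  refine ContinuousCohomology.map_two_eq_id_of_inner.{0, u, u} (geomTrivialRep E Λ)
    (⟨g, hg⟩⁻¹ : E.geom) (geomConj E g) (fun x => Subtype.ext ?_) (geomTrivialResHom E Λ g)
    (fun _ => rfl)
  simp only [coe_geomConj_apply, inv_inv, Subgroup.coe_mul, Subgroup.coe_inv]

/-- **`Δ_X` acts trivially on `M_X(Λ)`.** [cite: MochizukiAbsTopIII2015, Prop 1.4 (ii) p.31] -/
theorem cyclotomeModRep_of_mem_geom {g : E.arith} (hg : g ∈ E.geom) (m : CyclotomeMod E Λ) :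
    cyclotomeModRep E Λ g m = m := by
  have h1 : geomCyclotomeDualMap E Λ g m.toDual = m.toDual := by
    apply LinearMap.ext
    intro ξ
    rw [geomCyclotomeDualMap_apply, geomH2Map_of_mem_geom E Λ hg]
    rfl
  exact h1

/-- **The `Π_X`-action on `M_X(Λ)` factors through `G_k`**: elements of `Π_X` with the same image in
`G_k` act identically. [cite: MochizukiAbsTopIII2015, Cor 1.10 (ii) p.42] -/
theorem cyclotomeModRep_eq_of_aug_eq {g h : E.arith} (hgh : E.aug g = E.aug h) :
    cyclotomeModRep E Λ g = cyclotomeModRep E Λ h := by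
  have hmem : g * h⁻¹ ∈ E.geom := by
    change g * h⁻¹ ∈ E.aug.toMonoidHom.ker
    rw [MonoidHom.mem_ker, map_mul, map_inv]
    change E.aug g * (E.aug h)⁻¹ = 1
    rw [hgh, mul_inv_cancel]
  have hg : g = g * h⁻¹ * h := by rw [inv_mul_cancel_right]
  ext m
  conv_lhs => rw [hg]
  rw [map_mul]
  change cyclotomeModRep E Λ (g * h⁻¹) (cyclotomeModRep E Λ h m) = cyclotomeModRep E Λ h m
  rw [cyclotomeModRep_of_mem_geom E Λ hmem]

/-- **`M_X(Λ)` is a `G_k`-module**: there is a homomorphism `ρ̄ : G_k → End_ℤ(M_X(Λ))` (continuous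
linear endomorphisms) through which the `Π_X`-action factors, `ρ̄ ∘ (Π_X ↠ G_k) = ρ`; it is unique
because `Π_X ↠ G_k` is surjective. [cite: MochizukiAbsTopIII2015, Cor 1.10 (ii) p.42] -/
theorem exists_cyclotomeModRep_factor :
    ∃! ρ' : E.gal →* (CyclotomeMod E Λ →L[ℤ] CyclotomeMod E Λ),
      ∀ g : E.arith, ρ' (E.aug g) = cyclotomeModRep E Λ g := by
  classical
  let s : E.gal → E.arith := Function.surjInv E.aug_surjective
  have hs : ∀ γ, E.aug (s γ) = γ := Function.surjInv_eq E.aug_surjective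
  refine ⟨⟨⟨fun γ => cyclotomeModRep E Λ (s γ), ?_⟩, ?_⟩, ?_, ?_⟩
  · -- map_one
    have h : E.aug (s 1) = E.aug 1 := by rw [hs, map_one]
    change cyclotomeModRep E Λ (s 1) = 1
    rw [cyclotomeModRep_eq_of_aug_eq E Λ h, map_one]
  · intro γ γ'
    have h : E.aug (s (γ * γ')) = E.aug (s γ * s γ') := by rw [hs, map_mul, hs, hs]
    change cyclotomeModRep E Λ (s (γ * γ')) = cyclotomeModRep E Λ (s γ) * cyclotomeModRep E Λ (s γ')
    rw [cyclotomeModRep_eq_of_aug_eq E Λ h, map_mul]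
  · intro g
    change cyclotomeModRep E Λ (s (E.aug g)) = cyclotomeModRep E Λ g
    exact cyclotomeModRep_eq_of_aug_eq E Λ (hs (E.aug g))
  · intro ρ' hρ'
    ext γ : 1
    obtain ⟨g, rfl⟩ := E.aug_surjective γ
    rw [hρ' g]
    change cyclotomeModRep E Λ g = cyclotomeModRep E Λ (s (E.aug g))
    exact (cyclotomeModRep_eq_of_aug_eq E Λ (hs (E.aug g))).symm

end Literature.AnabelianGeometry.AbsoluteAnabelian.AbsTopIII
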